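import Literature.AlgebraicGeometry.ModuliOfAbelianVarieties.SiegelAdelicCongrTransport     -- ★ `AdelicCongr` calculus (`adelicVec`, `mem_latticeOfGL_iff`, …)
import Literature.AlgebraicGeometry.AbelianSchemes.SymplecticLiftOfIsogenyTower                -- ★ `map_fibreHom_restrictPt`
import HarnessLib

/-!
# The LEVEL READING of a marked fibre moves along a cover `c` to the quotient marking `u′ = c ∘ u`, for representatives congruent mod `N`

Topic `AlgebraicGeometry/ModuliOfAbelianVarieties`; namespace `Literature.AlgebraicGeometry.ModuliOfAbelianVarieties`.  THEOREMS ONLY (no definition, no named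
fact, no instance, no notation, no `sorry`; net debt 0).  Cell `hodgecm-mathlib`, FLOOR 0, P6 «MOD programme» (crux hLiu418 = stmt-HodgeConjecture-24832,
`--supports`), X-LEAF sheet line, organ (S1b)(m4) road (β) (A-p01 (g28) 2026-09-02T06:25:25Z), LAYER [L2-level]: the `hlevel` binder of ★
`SymplecticLiftOfMarking.exists_symplecticLift_of_levelReading` ∕ ★ `SymplecticLiftableOfMarkedFibre.isSymplecticLiftable_of_markedComplexFibre` for the
𝔞-QUOTIENT MARKING of ★ `SiegelAdelicMarkingIdealQuotient.exists_marking_of_idealKernel` (`u′ = c ∘ u`, representative `r = b̃(z)·r′`), from the level reading of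
the original marking (representative `r′`) — valid as soon as `r⁻¹ r′` is INTEGRAL and `≡ 1 (mod N)` (i.e. `z ≡ 1 mod N`, the (S6) representative ★
`RayClassIntegralIdeleRepresentative`), the familiar «`K(N)`-translates act trivially on `N`-torsion readings» ([Milne2005ShimuraVarieties] §6 p. 75 «level-`N`
structures correspond exactly»; [Deligne1971TravauxShimura] 4.16).

* §1 `mulVec_apply_mem_integralAdeles_of_forall_mem` (integral matrix × integral vector), **`AdelicCongr.mul_left_of_sub_one_mem`** — for `k` integral with
  `k − 1 ∈ N·M_{2g}(ẑ)` and `N·ŵ` integral: `R_{b,1}(v, w) → R_{k·b,1}(v, w)` (one-sided twin of ★ `adelicCongr_coe_mul_inv_iff_of_mem_principalLevelSubgroup`, which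
  needs `k ∈ K_δ(N)`; here `k = r⁻¹ r′ = r′⁻¹ b̃(z⁻¹) r′` is integral but NOT in `GL_{2g}(ẑ)`).
* §2 **`SiegelAdelicMarking.levelReading_comp_of_congr`** — `hlevel` for `(φ′, m′, r)` from `hlevel` for `(φ, m, r′)`, when `φ′.σ i = φ.σ i ≫ c`, `m′.r = c_s ∘ m.r`
  and `(r⁻¹ r′) − 1 ∈ N·M_{2g}(ẑ)` (★ `map_fibreHom_restrictPt`).
Budgets: default heartbeats.

References: [Milne2005ShimuraVarieties] J. S. Milne, *Introduction to Shimura varieties* (2005), §4 pp. 48–49, §6 Thm. 6.11 pp. 74–75, §12 (63) p. 116;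
[Deligne1971TravauxShimura] P. Deligne, *Travaux de Shimura* (1971), 4.12 (b) p. 149, 4.16 p. 150; [MumfordFogartyKirwan1994] Ch. 7 §1 Def. 7.1 (p. 129).
HC_CM is proved only modulo the printed citations (2 remaining named inputs hLiu418 24832, h413 24833) until rung 0 closes — count-neutral.
-/

set_option autoImplicit false

noncomputable section

open Matrix CategoryTheory AlgebraicGeometry NumberField IsDedekindDomain
open Literature.AlgebraicGeometry.Motives (AbelianVariety AlgPoints)
open Literature.AlgebraicGeometry.AbelianSchemes (AbelianSchemeOver)
open Literature.NumberTheory.Adeles (latticeOfGL)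

namespace Literature.AlgebraicGeometry.ModuliOfAbelianVarieties

variable {g : ℕ} {δ : Fin g → ℕ}

/-! ## §1 Integral translates congruent to `1 (mod N)` act trivially on `N`-torsion readings -/

/-- An integral matrix times a vector with integral coordinates has integral coordinates. [cite: Milne2005ShimuraVarieties, §4 pp. 48–49] -/
theorem mulVec_apply_mem_integralAdeles_of_forall_mem {M : Matrix (Fin g ⊕ Fin g) (Fin g ⊕ Fin g) finAdeleQ}
    (hM : ∀ i j, M i j ∈ FiniteAdeleRing.integralAdeles (𝓞 ℚ) ℚ) {y : Fin g ⊕ Fin g → finAdeleQ}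
    (hy : ∀ j, y j ∈ FiniteAdeleRing.integralAdeles (𝓞 ℚ) ℚ) (i : Fin g ⊕ Fin g) :
    (M *ᵥ y) i ∈ FiniteAdeleRing.integralAdeles (𝓞 ℚ) ℚ := by
  rw [Matrix.mulVec, dotProduct]
  exact sum_mem fun j _ => mul_mem (hM i j) (hy j)

/-- **An INTEGRAL translate `k ≡ 1 (mod N)` does not change readings of classes with denominator `N`**: if `k − 1 = N·t` entrywise with `t` integral
(so `k` is integral), `N·ŵ` is integral and `b v̂ ≡ ŵ (mod ẑ^{2g})`, then `(k b) v̂ ≡ ŵ (mod ẑ^{2g})` — `k(bv̂) − ŵ = k(bv̂ − ŵ) + t·(N ŵ)`, both integral.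
One-sided twin of ★ `adelicCongr_coe_mul_inv_iff_of_mem_principalLevelSubgroup` (there `k ∈ K_δ(N)`; here `k` need not be invertible over `ẑ` — the use is
`k = r⁻¹ r′ = r′⁻¹ b̃(z⁻¹) r′` for an idèle `z ≡ 1 mod N` generating `𝔞⁻¹`). [cite: Milne2005ShimuraVarieties, §6 Thm. 6.11 p. 74 and p. 75] [cite: Deligne1971TravauxShimura, 4.16 p. 150] -/
theorem AdelicCongr.mul_left_of_sub_one_mem {k b : GL (Fin g ⊕ Fin g) finAdeleQ} {N : ℕ} {v w : Fin g ⊕ Fin g → ℚ}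
    (hk : ∀ i j, ∃ t ∈ FiniteAdeleRing.integralAdeles (𝓞 ℚ) ℚ,
      ((k : Matrix (Fin g ⊕ Fin g) (Fin g ⊕ Fin g) finAdeleQ) - 1) i j = (N : finAdeleQ) * t)
    (hw : ∀ j, (N : finAdeleQ) * adelicVec w j ∈ FiniteAdeleRing.integralAdeles (𝓞 ℚ) ℚ)
    (h : AdelicCongr b 1 v w) : AdelicCongr (k * b) 1 v w := by
  classical
  -- `k` is integral: `k = 1 + N t`
  have hkint : ∀ i j, (k : Matrix (Fin g ⊕ Fin g) (Fin g ⊕ Fin g) finAdeleQ) i j ∈ FiniteAdeleRing.integralAdeles (𝓞 ℚ) ℚ := by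
    intro i j
    obtain ⟨t, ht, hkt⟩ := hk i j
    have e : (k : Matrix (Fin g ⊕ Fin g) (Fin g ⊕ Fin g) finAdeleQ) i j =
        (1 : Matrix (Fin g ⊕ Fin g) (Fin g ⊕ Fin g) finAdeleQ) i j + (N : finAdeleQ) * t := by
      rw [← hkt, Matrix.sub_apply]; ring
    rw [e]
    refine add_mem ?_ (mul_mem ?_ ht)
    · rw [Matrix.one_apply]
      split_ifs
      · exact one_mem _
      · exact zero_mem _
    · exact_mod_cast natCast_mem (FiniteAdeleRing.integralAdeles (𝓞 ℚ) ℚ) N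
  -- the defect `y := b v̂ − ŵ` is integral
  set y : Fin g ⊕ Fin g → finAdeleQ :=
    (b : Matrix (Fin g ⊕ Fin g) (Fin g ⊕ Fin g) finAdeleQ) *ᵥ adelicVec v - adelicVec w with hy
  have hyint : ∀ j, y j ∈ FiniteAdeleRing.integralAdeles (𝓞 ℚ) ℚ := fun j => by
    have hj := h j
    rwa [Units.val_one, Matrix.one_mulVec] at hj
  -- `(k − 1) ŵ` is integral
  have hkw : ∀ i, ((((k : Matrix (Fin g ⊕ Fin g) (Fin g ⊕ Fin g) finAdeleQ) - 1) *ᵥ adelicVec w) i) ∈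
      FiniteAdeleRing.integralAdeles (𝓞 ℚ) ℚ := by
    intro i
    rw [Matrix.mulVec, dotProduct]
    refine sum_mem fun j _ => ?_
    obtain ⟨t, ht, hkt⟩ := hk i j
    rw [hkt, mul_comm (N : finAdeleQ) t, mul_assoc]
    exact mul_mem ht (hw j)
  intro i
  have e : (((k * b : GL (Fin g ⊕ Fin g) finAdeleQ) : Matrix (Fin g ⊕ Fin g) (Fin g ⊕ Fin g) finAdeleQ) *ᵥ adelicVec v -
        ((1 : GL (Fin g ⊕ Fin g) finAdeleQ) : Matrix (Fin g ⊕ Fin g) (Fin g ⊕ Fin g) finAdeleQ) *ᵥ adelicVec w) i =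
      (((k : Matrix (Fin g ⊕ Fin g) (Fin g ⊕ Fin g) finAdeleQ)) *ᵥ y) i +
        ((((k : Matrix (Fin g ⊕ Fin g) (Fin g ⊕ Fin g) finAdeleQ) - 1) *ᵥ adelicVec w) i) := by
    rw [Units.val_mul, Units.val_one, Matrix.one_mulVec, ← Matrix.mulVec_mulVec, hy, Matrix.mulVec_sub, Matrix.sub_mulVec,
      Matrix.one_mulVec]
    simp only [Pi.sub_apply]
    ring
  rw [e]
  exact add_mem (mulVec_apply_mem_integralAdeles_of_forall_mem hkint hyint i) (hkw i)

/-! ## §2 The level reading moves along the cover to the quotient marking -/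

/-- **`hlevel` FOR THE QUOTIENT MARKING.**  Let `c : B → B′` be a homomorphism of abelian schemes over `S`, `s` a complex point, `m` a marking of `B_s` by
`[J, r′]` and `m′` a marking of `B′_s` by `[J′, r]` with `u′ = c_s ∘ u` (the output of ★ `exists_marking_of_idealKernel` ∕ `exists_marking_of_cover`), `φ`, `φ′` level-`N`
structures with `φ′.σ i = φ.σ i ≫ c`, and `(r⁻¹ r′) − 1 ∈ N·M_{2g}(ẑ)` entrywise.  If the sections of `φ` at `s` are read through `r′` at the classes `eᵢ∕N` (the
`hlevel` binder of ★ `exists_symplecticLift_of_levelReading`), then the sections of `φ′` at `s` are read through `r` at the same classes, BY THE SAME VECTORS.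
[cite: Milne2005ShimuraVarieties, §6 Thm. 6.11 p. 74 and §12 (63) p. 116] [cite: MumfordFogartyKirwan1994, Ch. 7 §1 Definition 7.1 (p. 129)] -/
theorem SiegelAdelicMarking.levelReading_comp_of_congr {J J' : C0pm δ} {r' r : gspFinAdelic δ}
    {S : Scheme.{0}} {B B' : AbelianSchemeOver S} {s : Spec (.of ℂ) ⟶ S} (c : B.X ⟶ B'.X) [IsMonHom c]
    (m : SiegelAdelicMarking J r' (B.fibre s).toAbelianVariety) (m' : SiegelAdelicMarking J' r (B'.fibre s).toAbelianVariety)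
    (hm' : ∀ v, m'.r v = AlgPoints.map (AbelianSchemeOver.fibreHom c s).hom.hom.hom (m.r v))
    {N : ℕ} (φ : B.LevelStructure g N) (φ' : B'.LevelStructure g N) (hφ' : ∀ i, φ'.σ i = φ.σ i ≫ c)
    (hk : ∀ i j, ∃ t ∈ FiniteAdeleRing.integralAdeles (𝓞 ℚ) ℚ,
      ((((r⁻¹ * r' : gspFinAdelic δ) : GL (Fin g ⊕ Fin g) finAdeleQ) : Matrix (Fin g ⊕ Fin g) (Fin g ⊕ Fin g) finAdeleQ) - 1) i j =
        (N : finAdeleQ) * t)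
    (hlevel : ∀ i : Fin g ⊕ Fin g, ∃ v : Fin g ⊕ Fin g → ℚ,
      AdelicCongr ((r'⁻¹ : gspFinAdelic δ) : GL (Fin g ⊕ Fin g) finAdeleQ) 1 v
          (fun j => (((Pi.single i (1 : ZMod N) : Fin g ⊕ Fin g → ZMod N) j).val : ℚ) / N) ∧
        B.restrictPt s (φ.σ i) = m.r v) :
    ∀ i : Fin g ⊕ Fin g, ∃ v : Fin g ⊕ Fin g → ℚ,
      AdelicCongr ((r⁻¹ : gspFinAdelic δ) : GL (Fin g ⊕ Fin g) finAdeleQ) 1 v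
          (fun j => (((Pi.single i (1 : ZMod N) : Fin g ⊕ Fin g → ZMod N) j).val : ℚ) / N) ∧
        B'.restrictPt s (φ'.σ i) = m'.r v := by
  intro i
  obtain ⟨v, hv, hσ⟩ := hlevel i
  refine ⟨v, ?_, ?_⟩
  · -- `r⁻¹ = (r⁻¹ r′) · r′⁻¹`, and `N · (eᵢ∕N)` is integral
    have hsplit : ((r⁻¹ : gspFinAdelic δ) : GL (Fin g ⊕ Fin g) finAdeleQ) =
        ((r⁻¹ * r' : gspFinAdelic δ) : GL (Fin g ⊕ Fin g) finAdeleQ) * ((r'⁻¹ : gspFinAdelic δ) : GL (Fin g ⊕ Fin g) finAdeleQ) := by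
      rw [← Subgroup.coe_mul, mul_assoc, mul_inv_cancel, mul_one]
    rw [hsplit]
    refine AdelicCongr.mul_left_of_sub_one_mem hk (fun j => ?_) hv
    rw [adelicVec_apply, ← map_natCast (algebraMap ℚ finAdeleQ) N, ← map_mul]
    by_cases hN : N = 0
    · subst hN
      simp only [Nat.cast_zero, zero_mul, map_zero]
      exact zero_mem _
    · have hval : ((N : ℚ) * ((((Pi.single i (1 : ZMod N) : Fin g ⊕ Fin g → ZMod N) j).val : ℚ) / N)) =
          ((((Pi.single i (1 : ZMod N) : Fin g ⊕ Fin g → ZMod N) j).val : ℕ) : ℚ) := by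
        field_simp
      rw [hval, map_natCast]
      exact_mod_cast natCast_mem (FiniteAdeleRing.integralAdeles (𝓞 ℚ) ℚ) _
  · rw [hφ' i, ← AbelianSchemeOver.map_fibreHom_restrictPt s c (φ.σ i), hσ, hm']

end Literature.AlgebraicGeometry.ModuliOfAbelianVarieties

end
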